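import Literature.AlgebraicGeometry.Motives.AbelianVarietyCubeBilinear
import HarnessLib

/-!
# The trivial locus of a divisor class at a RATIONAL point is read on the slice `X × {t₀}`
# (Görtz–Wedhorn II, Thm. 24.66 (1): «as sets `Z = {s ∈ S ; 𝓔_s is a free 𝒪_{X_s}-module}`», at a `K`-point `s`)

Layer `Literature/AlgebraicGeometry/Motives`, namespace `Literature.AlgebraicGeometry.Motives.CartierDivisor`.
KERNEL ONLY: theorems; no definition, no named fact, no instance, no `sorry`.

The tree's seesaw machinery (`Motives/SeesawTheorem`: `CartierDivisor.trivialLocus X T D = {t ∈ T ; 𝒪(D)|_{X_t} trivial}`,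
`mem_trivialLocus_iff`, ★ `seesaw_isClosed_trivialLocus_holds`, ★ `seesaw_exists_linEquiv_classPullback_holds`) reads
the fibre `X_t = X ×_K Spec κ(t)` at a SCHEME point `t` through `residuePtι T t : Spec κ(t) → T`.  Consumers that build
morphisms from closed graphs (★ `Motives/ClosedGraphMorphism.exists_hom_forall_comp_eq_of_isClosed`) work with
`K`-RATIONAL points `t₀ : 𝟙 = Spec K ⟶ T` and the slice `X ≅ X ×_K Spec K —X × t₀→ X ×_K T`.  This file is the seam:

* (private) `whiskerLeft_toUnit_comp_eq_fst_comp_slice` — `X ◁ (toUnit R ≫ t₀) = fst ≫ (ρ_X)⁻¹ ≫ X ◁ t₀`;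
* **`mem_trivialLocus_iff_classPullback_slice_linEquiv_zero`** — for a rational point `t₀ : 𝟙 ⟶ T` with underlying
  point `t = t₀(s)`: `t ∈ trivialLocus X T D ⟺ (D|_{X × {t₀}}) ∼ 0`, the restriction being the class pull-back along
  the slice `(ρ_X)⁻¹ ≫ X ◁ t₀ : X → X ×_K T` (the fibre over a rational point IS the slice: ★ `residuePtι_apply_eq`,
  ★ `isIso_fst_residuePt`, ★ `classPullback_comp_linEquiv`);
* `classPullback_slice_linEquiv_zero_of_mem_trivialLocus` / `mem_trivialLocus_of_classPullback_slice_linEquiv_zero`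
  (the two directions by name) and `forall_mem_trivialLocus_iff` (all rational points at once).

The pattern is the one already used for `Y^⊥` in ★ `Motives/AbelianVarietyPoincareOrthogonal.left_closedPoint_mem_orth_iff`,
stated here for ANY geometrically integral `X` and any `T` over `K` (cell `hodgecm-mathlib`, J0b road (i) step S3 of
`CENSUS-R3a`: the `ℂ`-points of the seesaw graph `Γ ⊆ T × Â` are read on slices).

## References
* [GortzWedhorn2023] U. Görtz, T. Wedhorn, *Algebraic Geometry II* (2023), Thm. 24.66 (1) (p. 543).
* [MumfordAV1970] D. Mumford, *Abelian Varieties* (1970), §5 Cor. 6 (seesaw) and §10 (p. 89, the graph argument).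
-/

noncomputable section

universe u

open CategoryTheory CategoryTheory.Limits AlgebraicGeometry MonoidalCategory CartesianMonoidalCategory

namespace Literature.AlgebraicGeometry.Motives

namespace CartierDivisor

variable {K : Type u} [Field K] (X T : SchemeOver K)

/-- **The fibre over a rational point is the slice**: `X ◁ (toUnit R ≫ t₀) = fst ≫ (ρ_X)⁻¹ ≫ X ◁ t₀` for any `R` over `K`
(both are `(x, r) ↦ (x, t₀)`). [folklore] -/
private theorem whiskerLeft_toUnit_comp_eq_fst_comp_slice (R : SchemeOver K) (t₀ : 𝟙_ (SchemeOver K) ⟶ T) :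
    X ◁ (toUnit R ≫ t₀) = fst X R ≫ (ρ_ X).inv ≫ X ◁ t₀ := by
  ext <;> simp

variable [GeometricallyIntegral X.hom] [IsIntegral X.left] [IsIntegral (X ⊗ T).left]

/-- **The trivial locus at a rational point is read on the slice `X × {t₀}`** (Görtz–Wedhorn II 24.66 (1) at a
`K`-point): for `t₀ : Spec K ⟶ T` over `K` with underlying point `t = t₀(s)` and a Cartier divisor `D` on `X ×_K T`,
`t ∈ trivialLocus X T D` iff the class pull-back of `D` along the slice `X ≅ X ×_K Spec K —X × t₀→ X ×_K T` is
linearly trivial.  Proof: `Spec κ(t) → T` is `Spec κ(t) → Spec K —t₀→ T` (★ `residuePtι_apply_eq`), so the fibre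
`X_t → X ×_K T` is `pr_X ≫ slice` with `pr_X : X ×_K Spec κ(t) → X` an ISOMORPHISM (★ `isIso_fst_residuePt`); class
pull-backs are functorial up to `∼` (★ `classPullback_comp_linEquiv`) and triviality moves both ways across an iso.
[cite: GortzWedhorn2023, Thm. 24.66 (1) (p. 543)] -/
theorem mem_trivialLocus_iff_classPullback_slice_linEquiv_zero (D : CartierDivisor (X ⊗ T).left)
    (t₀ : 𝟙_ (SchemeOver K) ⟶ T) (s : (𝟙_ (SchemeOver K)).left) :
    t₀.left s ∈ trivialLocus X T D ↔ (D.classPullback ((ρ_ X).inv ≫ X ◁ t₀).left).LinEquiv 0 := by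
  rw [mem_trivialLocus_iff, residuePtι_apply_eq, whiskerLeft_toUnit_comp_eq_fst_comp_slice X T _ t₀, Over.comp_left]
  have hc := D.classPullback_comp_linEquiv ((ρ_ X).inv ≫ X ◁ t₀).left (fst X (residuePt T (t₀.left s))).left
  haveI := AbelianVariety.isIso_fst_residuePt X T t₀ s
  set f := fst X (residuePt T (t₀.left s))
  constructor
  · intro h
    -- pull back along the inverse of the isomorphism `f`
    have h1 : ((D.classPullback ((ρ_ X).inv ≫ X ◁ t₀).left).classPullback f.left).LinEquiv 0 := hc.symm.trans h
    have h2 := h1.classPullback_zero (inv f).left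
    have h3 := (D.classPullback ((ρ_ X).inv ≫ X ◁ t₀).left).classPullback_comp_linEquiv f.left (inv f).left
    rw [← Over.comp_left, IsIso.inv_hom_id, Over.id_left] at h3
    exact ((D.classPullback _).classPullback_id_linEquiv.symm.trans h3).trans h2
  · intro h
    exact hc.trans (h.classPullback_zero _)

/-- `→` of `mem_trivialLocus_iff_classPullback_slice_linEquiv_zero`, by name. [cite: GortzWedhorn2023, Thm. 24.66 (1) (p. 543)] -/
theorem classPullback_slice_linEquiv_zero_of_mem_trivialLocus {D : CartierDivisor (X ⊗ T).left}
    {t₀ : 𝟙_ (SchemeOver K) ⟶ T} {s : (𝟙_ (SchemeOver K)).left} (h : t₀.left s ∈ trivialLocus X T D) :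
    (D.classPullback ((ρ_ X).inv ≫ X ◁ t₀).left).LinEquiv 0 :=
  (mem_trivialLocus_iff_classPullback_slice_linEquiv_zero X T D t₀ s).1 h

/-- `←` of `mem_trivialLocus_iff_classPullback_slice_linEquiv_zero`, by name. [cite: GortzWedhorn2023, Thm. 24.66 (1) (p. 543)] -/
theorem mem_trivialLocus_of_classPullback_slice_linEquiv_zero {D : CartierDivisor (X ⊗ T).left}
    (t₀ : 𝟙_ (SchemeOver K) ⟶ T) (s : (𝟙_ (SchemeOver K)).left)
    (h : (D.classPullback ((ρ_ X).inv ≫ X ◁ t₀).left).LinEquiv 0) : t₀.left s ∈ trivialLocus X T D :=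
  (mem_trivialLocus_iff_classPullback_slice_linEquiv_zero X T D t₀ s).2 h

/-- **All rational points at once**: the trivial locus contains the underlying point of every rational point iff every
slice class `D|_{X × {t₀}}` is trivial — the hypothesis shape under which, for `T` Jacobson (locally of finite type
over `K = K̄`), the CLOSED trivial locus (★ `seesaw_isClosed_trivialLocus_holds`) is all of `T` (★
`Motives.eq_univ_of_isClosed_of_forall_pt_mem`) and the seesaw conclusion ★ `seesaw_exists_linEquiv_classPullback_holds`
applies. [cite: GortzWedhorn2023, Thm. 24.66 (1) (p. 543)] [cite: MumfordAV1970, §5 Cor. 6 (seesaw)] -/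
theorem forall_mem_trivialLocus_iff (D : CartierDivisor (X ⊗ T).left) :
    (∀ (t₀ : 𝟙_ (SchemeOver K) ⟶ T) (s : (𝟙_ (SchemeOver K)).left), t₀.left s ∈ trivialLocus X T D) ↔
      ∀ t₀ : 𝟙_ (SchemeOver K) ⟶ T, (D.classPullback ((ρ_ X).inv ≫ X ◁ t₀).left).LinEquiv 0 := by
  constructor
  · intro h t₀
    exact (mem_trivialLocus_iff_classPullback_slice_linEquiv_zero X T D t₀ (IsLocalRing.closedPoint K)).1
      (h t₀ _)
  · intro h t₀ s
    exact (mem_trivialLocus_iff_classPullback_slice_linEquiv_zero X T D t₀ s).2 (h t₀)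

end CartierDivisor

end Literature.AlgebraicGeometry.Motives

end
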